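import Summits.Ventures.PercRepro.RLSRuleOneLineSixSupply
import Summits.Ventures.PercRepro.RLSZeroWorldT1C
import Summits.Ventures.PercRepro.RLSPlanesT2_1
import Summits.Ventures.PercRepro.RLSPlanesT3_1
import Summits.Ventures.PercRepro.RLSSmallP

/-!
# C-025 at q = 3: `R₃⁺` on the `6`-point plane with one `3`-point line at EVERY type (night-3, gen 4)

The first plane outside `𝒯₀` at every type on the core, by the profile machine of `RLSRuleProfileSums`:

* `t = 1` (`|K| = n + 3`): demand `≤ 40`, the lifted certificate `W1.t1_one6B`;
* `t = 2` (`|K| = n + 2`): no line in `cl(E ∖ G)` (the loss sums are charged anyway — the margin allows it);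
  demand `≤ 34`; `U2.Planes1.plane10_t2` (+ `SmallP.plane10_t2_n4`) after dropping the losses;
  NOTE: at `t = 2` the fictitious losses are NOT affordable for the planes with more lines; here the no-loss form is
  recovered by `coplanarTriples_eq_empty_of_two_le` (`Λ = ∅`, `oneLineSix_supply_free`);
* `t = 3` (`|K| = n + 1`): no loss; the demand is the `18` independent triples with independent complement
  (`eRk_sdiff_ge_of_mem_UqG`); `U3.Planes1.plane10_t3`;
* `t = 0`: `perFlat_oneLine`; `t ≥ 4`: no demand.

**`perFlat_oneLineSix_all`**: on `Core M (n + 4)`, `n ≥ 4`, every plane `ℓ ∪ {a, b, c}` satisfies the per-flat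
inequality of `R₃⁺`.  Imports `RLSRuleOneLineSixSupply`, `RLSZeroWorldT1C`, the landed tables `RLSPlanesT2_1`,
`RLSPlanesT3_1`, `RLSSmallP`.  Axioms: standard.
-/

open scoped Matroid

namespace PercRepro

namespace NightThree

open Finset ThmH PerFlat

variable {α : Type*} [DecidableEq α] {M : Matroid α} [M.Finite]

/-! ### The demand -/

/-- At `t = 1` the bottom sets of `ℓ ∪ {a, b, c}` are among the triples, the `4`- and the `5`-subsets: `≤ 40`. -/
theorem card_UqG_le_oneLineSix_t1 {G ℓ : Finset α} {n : ℕ} (h : OneLine M G ℓ) (hGc : G.card = 6)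
    (hK : M.eRk ((gr M \ G : Finset α) : Set α) = ((n + 3 : ℕ) : ℕ∞)) : (UqG M (n + 4) 3 G).card ≤ 40 := by
  obtain ⟨hℓG, hℓc, hℓr, hone⟩ := h
  have hsub : UqG M (n + 4) 3 G ⊆ (G.powersetCard 3).erase ℓ ∪ G.powersetCard 4 ∪ G.powersetCard 5 := by
    intro B hB
    have hle := card_add_le_of_mem_UqG hB hK (by omega : n + 3 + 1 ≤ n + 4)
    have hB' := hB
    unfold UqG at hB'
    rw [Finset.mem_filter, mem_Uq] at hB'
    obtain ⟨⟨_, hB3, _⟩, hBG⟩ := hB'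
    have hB3' : M.eRk (B : Set α) = 3 := by exact_mod_cast hB3
    have hBc := three_le_card_of_eRk_eq_three hB3'
    simp only [Finset.mem_union, Finset.mem_erase, Finset.mem_powersetCard]
    rcases (show B.card = 3 ∨ B.card = 4 ∨ B.card = 5 by omega) with h3 | h4 | h5
    · left; left
      refine ⟨?_, hBG, h3⟩
      rintro rfl; rw [hℓr] at hB3'; exact absurd hB3' (by decide)
    · left; right; exact ⟨hBG, h4⟩
    · right; exact ⟨hBG, h5⟩
  calc (UqG M (n + 4) 3 G).card ≤ ((G.powersetCard 3).erase ℓ ∪ G.powersetCard 4 ∪ G.powersetCard 5).card :=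
        Finset.card_le_card hsub
    _ ≤ ((G.powersetCard 3).erase ℓ ∪ G.powersetCard 4).card + (G.powersetCard 5).card := Finset.card_union_le _ _
    _ ≤ ((G.powersetCard 3).erase ℓ).card + (G.powersetCard 4).card + (G.powersetCard 5).card := by
        have := Finset.card_union_le ((G.powersetCard 3).erase ℓ) (G.powersetCard 4); omega
    _ = 40 := by
        rw [Finset.card_erase_of_mem (Finset.mem_powersetCard.2 ⟨hℓG, hℓc⟩), Finset.card_powersetCard,
          Finset.card_powersetCard, Finset.card_powersetCard, hGc]
        rfl

/-- At `t = 2` the bottom sets are among the triples and the `4`-subsets: `≤ 34`. -/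
theorem card_UqG_le_oneLineSix_t2 {G ℓ : Finset α} {n : ℕ} (h : OneLine M G ℓ) (hGc : G.card = 6)
    (hK : M.eRk ((gr M \ G : Finset α) : Set α) = ((n + 2 : ℕ) : ℕ∞)) : (UqG M (n + 4) 3 G).card ≤ 34 := by
  obtain ⟨hℓG, hℓc, hℓr, hone⟩ := h
  have hsub : UqG M (n + 4) 3 G ⊆ (G.powersetCard 3).erase ℓ ∪ G.powersetCard 4 := by
    intro B hB
    have hle := card_add_le_of_mem_UqG hB hK (by omega : n + 2 + 2 ≤ n + 4)
    have hB' := hB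
    unfold UqG at hB'
    rw [Finset.mem_filter, mem_Uq] at hB'
    obtain ⟨⟨_, hB3, _⟩, hBG⟩ := hB'
    have hB3' : M.eRk (B : Set α) = 3 := by exact_mod_cast hB3
    have hBc := three_le_card_of_eRk_eq_three hB3'
    simp only [Finset.mem_union, Finset.mem_erase, Finset.mem_powersetCard]
    rcases (show B.card = 3 ∨ B.card = 4 by omega) with h3 | h4
    · left
      refine ⟨?_, hBG, h3⟩
      rintro rfl; rw [hℓr] at hB3'; exact absurd hB3' (by decide)
    · right; exact ⟨hBG, h4⟩
  calc (UqG M (n + 4) 3 G).card ≤ ((G.powersetCard 3).erase ℓ ∪ G.powersetCard 4).card := Finset.card_le_card hsub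
    _ ≤ ((G.powersetCard 3).erase ℓ).card + (G.powersetCard 4).card := Finset.card_union_le _ _
    _ = 34 := by
        rw [Finset.card_erase_of_mem (Finset.mem_powersetCard.2 ⟨hℓG, hℓc⟩), Finset.card_powersetCard,
          Finset.card_powersetCard, hGc]
        rfl

/-- At `t = 3` the bottom sets are the independent triples whose complement is independent: `≤ 18`. -/
theorem card_UqG_le_oneLineSix_t3 {G ℓ : Finset α} {n : ℕ} (h : OneLine M G ℓ) (hGc : G.card = 6)
    (hK : M.eRk ((gr M \ G : Finset α) : Set α) = ((n + 1 : ℕ) : ℕ∞)) : (UqG M (n + 4) 3 G).card ≤ 18 := by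
  obtain ⟨hℓG, hℓc, hℓr, hone⟩ := h
  have hsub : UqG M (n + 4) 3 G ⊆ ((G.powersetCard 3).erase ℓ).erase (G \ ℓ) := by
    intro B hB
    have hle := card_add_le_of_mem_UqG hB hK (by omega : n + 1 + 3 ≤ n + 4)
    have hge := eRk_sdiff_ge_of_mem_UqG hB hK (by omega : n + 1 + 3 ≤ n + 4)
    have hB' := hB
    unfold UqG at hB'
    rw [Finset.mem_filter, mem_Uq] at hB'
    obtain ⟨⟨_, hB3, _⟩, hBG⟩ := hB'
    have hB3' : M.eRk (B : Set α) = 3 := by exact_mod_cast hB3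
    have hBc := three_le_card_of_eRk_eq_three hB3'
    simp only [Finset.mem_erase, Finset.mem_powersetCard]
    refine ⟨?_, ?_, hBG, by omega⟩
    · intro hBeq
      have : G \ B = ℓ := by rw [hBeq, Finset.sdiff_sdiff_eq_self hℓG]
      rw [this, hℓr] at hge
      exact absurd hge (by decide)
    · rintro rfl; rw [hℓr] at hB3'; exact absurd hB3' (by decide)
  calc (UqG M (n + 4) 3 G).card ≤ (((G.powersetCard 3).erase ℓ).erase (G \ ℓ)).card := Finset.card_le_card hsub
    _ = 18 := by
        have hmem : G \ ℓ ∈ (G.powersetCard 3).erase ℓ := by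
          rw [Finset.mem_erase, Finset.mem_powersetCard]
          refine ⟨?_, Finset.sdiff_subset, by rw [Finset.card_sdiff_of_subset hℓG, hGc, hℓc]⟩
          intro heq
          have hdisj : Disjoint (G \ ℓ) ℓ := Finset.sdiff_disjoint
          rw [heq] at hdisj
          have := (Finset.disjoint_self_iff_empty ℓ).1 hdisj
          rw [this, Finset.card_empty] at hℓc
          exact absurd hℓc (by norm_num)
        rw [Finset.card_erase_of_mem hmem, Finset.card_erase_of_mem (Finset.mem_powersetCard.2 ⟨hℓG, hℓc⟩),
          Finset.card_powersetCard, hGc]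
        rfl

/-! ### The three types and the wrapper -/

/-- **`R₃⁺` at `t = 1` on the plane `ℓ ∪ {a, b, c}`**, every `p = n + 4 ≥ 8`, on the core: the line charged its
`(L3)` loss everywhere, the demand `≤ 40`, the certificate `W1.t1_one6B`. -/
theorem perFlat_oneLineSix_t1 {G ℓ : Finset α} {n : ℕ} (hc : Core M (n + 4)) (hG : G ∈ flatsQ M 3)
    (h : OneLine M G ℓ) (hGc : G.card = 6) (hn : 4 ≤ n)
    (hK : M.eRk ((gr M \ G : Finset α) : Set α) = ((n + 3 : ℕ) : ℕ∞)) :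
    phiK (n + 4) 3 * ((UqG M (n + 4) 3 G).card : ℚ) ≤ ∑ S ∈ Yq M (n + 4) 3, wPlus M G S := by
  classical
  obtain ⟨K, hKsub, hKind, hKcard⟩ := exists_indep_compl_card G (p := n + 3) (le_of_eq hK.symm)
  obtain ⟨C₀, hC₀K, hC₀c, hgoodC⟩ := exists_good_triple hG h.1 h.2.2.1 hKsub hKind (by rw [hKcard]; omega)
  have hsup := oneLineSix_supply hc hG h hGc hKsub hKind (n := n) (N := n) hKcard (by omega) hC₀K hC₀c hgoodC
  -- the sums in the landed vocabulary
  have e0 := sum_witness_eq_t1z0 hKcard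
  have e1 := sum_witness_eq_t1z1 hKcard
  have e1' : ∑ X ∈ witnessFamily K n, 4 / (((4 + X.card).choose 3 : ℕ) : ℚ) = 4 * W1.t1z1Sum n := by
    rw [sum_witnessFamily K n (fun x => 4 / (((4 + x).choose 3 : ℕ) : ℚ)), hKcard]
    unfold W1.t1z1Sum; rw [Finset.mul_sum]; apply Finset.sum_congr rfl; intro i _
    rw [show 4 + (i + 1) = i + 5 by omega]; ring
  have e2 : ∑ X ∈ witnessFamily K n, 9 / (((5 + X.card).choose 3 : ℕ) : ℚ) = 9 * W1.t1z2Sum n := by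
    rw [sum_witnessFamily K n (fun x => 9 / (((5 + x).choose 3 : ℕ) : ℚ)), hKcard]
    unfold W1.t1z2Sum; rw [Finset.mul_sum]; apply Finset.sum_congr rfl; intro i _
    rw [show 5 + (i + 1) = i + 6 by omega]; ring
  have e2' : ∑ X ∈ witnessFamily K n, 10 / (((5 + X.card).choose 3 : ℕ) : ℚ) = 10 * W1.t1z2Sum n := by
    rw [sum_witnessFamily K n (fun x => 10 / (((5 + x).choose 3 : ℕ) : ℚ)), hKcard]
    unfold W1.t1z2Sum; rw [Finset.mul_sum]; apply Finset.sum_congr rfl; intro i _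
    rw [show 5 + (i + 1) = i + 6 by omega]; ring
  have eW : ∑ _X ∈ witnessFamily K n, (1 : ℚ) = U1.w1Sum n := by
    rw [sum_witnessFamily K n (fun _ => (1 : ℚ)), hKcard]
    unfold U1.w1Sum; apply Finset.sum_congr rfl; intro i _; ring
  have l1 : ∑ j ∈ range (n - 2), (n.choose j : ℚ) * (3 / (((4 + (j + 3)).choose 3 : ℕ) : ℚ)) = 3 * W1.t1lost4Sum n := by
    unfold W1.t1lost4Sum; rw [Finset.mul_sum]; apply Finset.sum_congr rfl; intro j _
    rw [show 4 + (j + 3) = j + 7 by omega]; ring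
  have l2 : ∑ j ∈ range (n - 2), (n.choose j : ℚ) * (9 / (((5 + (j + 3)).choose 3 : ℕ) : ℚ)) = 9 * W1.t1lost5Sum n := by
    unfold W1.t1lost5Sum; rw [Finset.mul_sum]; apply Finset.sum_congr rfl; intro j _
    rw [show 5 + (j + 3) = j + 8 by omega]; ring
  have lW : ∑ j ∈ range (n - 2), (n.choose j : ℚ) * (1 : ℚ) = W1.t1lostSum n := by
    unfold W1.t1lostSum; apply Finset.sum_congr rfl; intro j _; ring
  rw [e0, e1, e1', e2, e2', eW, l1, l2, lW] at hsup
  -- the demand and the certificate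
  have hdem : ((UqG M (n + 4) 3 G).card : ℚ) ≤ 40 := by exact_mod_cast card_UqG_le_oneLineSix_t1 h hGc hK
  have hphi : phiK (n + 4) 3 = ∑ i ∈ range n, ((n + 4).choose (i + 1) : ℚ) / ((i + 4).choose 3 : ℚ) := by
    unfold phiK; rw [phiW_eq_phiK_form n]; rfl
  have hcert := W1.t1_one6B n hn
  rw [← hphi] at hcert
  calc phiK (n + 4) 3 * ((UqG M (n + 4) 3 G).card : ℚ)
      ≤ phiK (n + 4) 3 * 40 := mul_le_mul_of_nonneg_left hdem (phiK_nonneg _ _)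
    _ ≤ ∑ S ∈ Yq M (n + 4) 3, wPlus M G S := by linarith

/-- **`R₃⁺` at `t = 2` on the plane `ℓ ∪ {a, b, c}`**, every `p = n + 4 ≥ 8`, on the core: no loss, demand `≤ 34`,
the pure form `U2.Planes1.plane10_t2` (`n = 4`: `SmallP.plane10_t2_n4`). -/
theorem perFlat_oneLineSix_t2 {G ℓ : Finset α} {n : ℕ} (hc : Core M (n + 4)) (hG : G ∈ flatsQ M 3)
    (h : OneLine M G ℓ) (hGc : G.card = 6) (hn : 4 ≤ n)
    (hK : M.eRk ((gr M \ G : Finset α) : Set α) = ((n + 2 : ℕ) : ℕ∞)) :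
    phiK (n + 4) 3 * ((UqG M (n + 4) 3 G).card : ℚ) ≤ ∑ S ∈ Yq M (n + 4) 3, wPlus M G S := by
  classical
  obtain ⟨K, hKsub, hKind, hKcard⟩ := exists_indep_compl_card G (p := n + 2) (le_of_eq hK.symm)
  have hlt : M.eRk ((gr M \ G : Finset α) : Set α) + 1 < M.eRank := by
    rw [hK, hc.2.1]
    calc ((n + 2 : ℕ) : ℕ∞) + 1 = ((n + 3 : ℕ) : ℕ∞) := by push_cast; ring
      _ < ((n + 4 : ℕ) : ℕ∞) := by exact_mod_cast (by omega : n + 3 < n + 4)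
  have hℓ : ℓ ∈ depTriples M G := by
    rw [depTriples_eq_singleton_of_oneLine h]; exact Finset.mem_singleton_self ℓ
  have hemp := coplanarTriples_eq_empty_of_two_le hc hG hℓ hKsub hKind hlt
  have hsup := oneLineSix_supply_free hc hG h hGc hKsub hKind (n := n) hemp
  have e0 : ∑ X ∈ witnessFamily K n, 1 / (((3 + X.card).choose 3 : ℕ) : ℚ) = U2.r0Sum n := by
    rw [sum_witnessFamily K n (fun x => 1 / (((3 + x).choose 3 : ℕ) : ℚ)), hKcard]
    unfold U2.r0Sum; apply Finset.sum_congr rfl; intro i _; rw [show 3 + (i + 1) = i + 4 by omega]; ring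
  have e1 : ∑ X ∈ witnessFamily K n, 1 / (((4 + X.card).choose 3 : ℕ) : ℚ) = U2.r1Sum n := by
    rw [sum_witnessFamily K n (fun x => 1 / (((4 + x).choose 3 : ℕ) : ℚ)), hKcard]
    unfold U2.r1Sum; apply Finset.sum_congr rfl; intro i _; rw [show 4 + (i + 1) = i + 5 by omega]; ring
  have e2 : ∑ X ∈ witnessFamily K n, 1 / (((5 + X.card).choose 3 : ℕ) : ℚ) = U2.r2Sum n := by
    rw [sum_witnessFamily K n (fun x => 1 / (((5 + x).choose 3 : ℕ) : ℚ)), hKcard]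
    unfold U2.r2Sum; apply Finset.sum_congr rfl; intro i _; rw [show 5 + (i + 1) = i + 6 by omega]; ring
  have eW : ∑ _X ∈ witnessFamily K n, (1 : ℚ) = U2.w2Sum n := by
    rw [sum_witnessFamily K n (fun _ => (1 : ℚ)), hKcard]
    unfold U2.w2Sum; apply Finset.sum_congr rfl; intro i _; ring
  rw [e0, e1, e2, eW] at hsup
  have hdem : ((UqG M (n + 4) 3 G).card : ℚ) ≤ 34 := by exact_mod_cast card_UqG_le_oneLineSix_t2 h hGc hK
  have hphi : phiK (n + 4) 3 = ∑ i ∈ range n, ((n + 4).choose (i + 1) : ℚ) / ((i + 4).choose 3 : ℚ) := by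
    unfold phiK; rw [phiW_eq_phiK_form n]; rfl
  have hcert : phiK (n + 4) 3 * 34 ≤ 19 * U2.r0Sum n + 57 * U2.r1Sum n + 57 * U2.r2Sum n + 1 * U2.w2Sum n := by
    rw [hphi]
    rcases (show n = 4 ∨ 5 ≤ n by omega) with h4 | h5
    · subst h4; exact SmallP.plane10_t2_n4
    · exact U2.Planes1.plane10_t2 n h5
  calc phiK (n + 4) 3 * ((UqG M (n + 4) 3 G).card : ℚ)
      ≤ phiK (n + 4) 3 * 34 := mul_le_mul_of_nonneg_left hdem (phiK_nonneg _ _)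
    _ ≤ ∑ S ∈ Yq M (n + 4) 3, wPlus M G S := by linarith

/-- **`R₃⁺` at `t = 3` on the plane `ℓ ∪ {a, b, c}`**, every `p = n + 4 ≥ 8`, on the core: no loss, the `18` demanded
triples, the pure form `U3.Planes1.plane10_t3`. -/
theorem perFlat_oneLineSix_t3 {G ℓ : Finset α} {n : ℕ} (hc : Core M (n + 4)) (hG : G ∈ flatsQ M 3)
    (h : OneLine M G ℓ) (hGc : G.card = 6) (hn : 4 ≤ n)
    (hK : M.eRk ((gr M \ G : Finset α) : Set α) = ((n + 1 : ℕ) : ℕ∞)) :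
    phiK (n + 4) 3 * ((UqG M (n + 4) 3 G).card : ℚ) ≤ ∑ S ∈ Yq M (n + 4) 3, wPlus M G S := by
  classical
  obtain ⟨K, hKsub, hKind, hKcard⟩ := exists_indep_compl_card G (p := n + 1) (le_of_eq hK.symm)
  have hlt : M.eRk ((gr M \ G : Finset α) : Set α) + 1 < M.eRank := by
    rw [hK, hc.2.1]
    calc ((n + 1 : ℕ) : ℕ∞) + 1 = ((n + 2 : ℕ) : ℕ∞) := by push_cast; ring
      _ < ((n + 4 : ℕ) : ℕ∞) := by exact_mod_cast (by omega : n + 2 < n + 4)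
  have hℓ : ℓ ∈ depTriples M G := by
    rw [depTriples_eq_singleton_of_oneLine h]; exact Finset.mem_singleton_self ℓ
  have hemp := coplanarTriples_eq_empty_of_two_le hc hG hℓ hKsub hKind hlt
  have hsup := oneLineSix_supply_free hc hG h hGc hKsub hKind (n := n) hemp
  have e0 : ∑ X ∈ witnessFamily K n, 1 / (((3 + X.card).choose 3 : ℕ) : ℚ) = U3.u0Sum n := by
    rw [sum_witnessFamily K n (fun x => 1 / (((3 + x).choose 3 : ℕ) : ℚ)), hKcard]
    unfold U3.u0Sum; apply Finset.sum_congr rfl; intro i _; rw [show 3 + (i + 1) = i + 4 by omega]; ring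
  have e1 : ∑ X ∈ witnessFamily K n, 1 / (((4 + X.card).choose 3 : ℕ) : ℚ) = U3.u1Sum n := by
    rw [sum_witnessFamily K n (fun x => 1 / (((4 + x).choose 3 : ℕ) : ℚ)), hKcard]
    unfold U3.u1Sum; apply Finset.sum_congr rfl; intro i _; rw [show 4 + (i + 1) = i + 5 by omega]; ring
  have e2 : ∑ X ∈ witnessFamily K n, 1 / (((5 + X.card).choose 3 : ℕ) : ℚ) = U3.u2Sum n := by
    rw [sum_witnessFamily K n (fun x => 1 / (((5 + x).choose 3 : ℕ) : ℚ)), hKcard]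
    unfold U3.u2Sum; apply Finset.sum_congr rfl; intro i _; rw [show 5 + (i + 1) = i + 6 by omega]; ring
  have eW : ∑ _X ∈ witnessFamily K n, (1 : ℚ) = U3.w3Sum n := by
    rw [sum_witnessFamily K n (fun _ => (1 : ℚ)), hKcard]
    unfold U3.w3Sum; apply Finset.sum_congr rfl; intro i _; ring
  rw [e0, e1, e2, eW] at hsup
  have hdem : ((UqG M (n + 4) 3 G).card : ℚ) ≤ 18 := by exact_mod_cast card_UqG_le_oneLineSix_t3 h hGc hK
  have hphi : phiK (n + 4) 3 = ∑ i ∈ range n, ((n + 4).choose (i + 1) : ℚ) / ((i + 4).choose 3 : ℚ) := by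
    unfold phiK; rw [phiW_eq_phiK_form n]; rfl
  have hcert := U3.Planes1.plane10_t3 n hn
  rw [← hphi] at hcert
  calc phiK (n + 4) 3 * ((UqG M (n + 4) 3 G).card : ℚ)
      ≤ phiK (n + 4) 3 * 18 := mul_le_mul_of_nonneg_left hdem (phiK_nonneg _ _)
    _ ≤ ∑ S ∈ Yq M (n + 4) 3, wPlus M G S := by linarith

open scoped Classical in
/-- **`R₃⁺` on the plane `ℓ ∪ {a, b, c}` at EVERY type**, every `p = n + 4 ≥ 8`, on a core matroid — the first
plane outside `𝒯₀` closed at every type. -/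
theorem perFlat_oneLineSix_all {G ℓ : Finset α} {n : ℕ} (hc : Core M (n + 4)) (hG : G ∈ flatsQ M 3)
    (h : OneLine M G ℓ) (hGc : G.card = 6) (hn : 4 ≤ n) :
    phiK (n + 4) 3 * ((UqG M (n + 4) 3 G).card : ℚ) ≤ ∑ S ∈ Yq M (n + 4) 3, wPlus M G S := by
  obtain ⟨e, he, _⟩ := eRk_eq_nat M (gr M \ G)
  rcases le_or_gt (n + 4) e with h0 | h0
  · exact perFlat_oneLine hG h hn (by rw [he]; exact_mod_cast h0)
  rcases Nat.lt_or_ge e (n + 1) with h4 | h1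
  · -- `t ≥ 4`: no demand
    have hdem := card_UqG_le_of_eRk_compl G (p := n + 4) (t := 4) he (by omega)
    have h0' : demandCount G.card 4 = 0 := by
      rw [hGc]
      unfold demandCount
      norm_num [Finset.sum_range_succ]
    rw [h0'] at hdem
    have hU : ((UqG M (n + 4) 3 G).card : ℚ) = 0 := le_antisymm hdem (by positivity)
    rw [hU, mul_zero]
    exact Finset.sum_nonneg (fun S _ => wPlus_nonneg M G S)
  rcases (show e = n + 1 ∨ e = n + 2 ∨ e = n + 3 by omega) with h1' | h2' | h3'
  · exact perFlat_oneLineSix_t3 hc hG h hGc hn (by rw [he, h1'])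
  · exact perFlat_oneLineSix_t2 hc hG h hGc hn (by rw [he, h2'])
  · exact perFlat_oneLineSix_t1 hc hG h hGc hn (by rw [he, h3'])

end NightThree

end PercRepro
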